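import Literature.NumberTheory.ComplexMultiplication.CMTypeDistinguishedElementReflexField
import HarnessLib

/-!
# The reflex field of a signature `r : Hom(F, ℂ) → ℕ` (Kottwitz: «the field of definition of the isomorphism class of the
# complex representation `V₁` of `B`», `B = F` a number field): `E_r = ℚ(∑_φ r_φ φ(a) ∣ a ∈ F)`, `Aut(ℂ/E_r) = Stab(r)`,
# the coefficients of `det(X − a ∣ V₁) = ∏_φ (X − φ(a))^{r_φ}` lie in `E_r`; `E_{𝟙_Φ} = K*`; and for RSZ's `r`:
# `E_r · E_Φ = E_Φ · φ₀(F)` («the composite of the reflex field of `r` and the reflex field of `Φ`»), `E_r = E` for `n ≥ 3`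

Layer `Literature/NumberTheory/ComplexMultiplication`, namespace `Literature.NumberTheory.ComplexMultiplication` (lane
`lit-hodgefound`, Track 2 foundations, Layer A3; seat `lit-hodgefound-p11`, generation 28, row g28-#4).  Sequel of
`CMTypeDistinguishedElementReflexField` (g28-#1: RSZ's `E = E_Φ · φ₀(F)`; the signature function `r` at the level of
stabilisers only).  THEOREMS ONLY (D-0026): no definition, no named fact, no instance — the reflex field of `r` is WRITTEN
OUT as `IntermediateField.adjoin ℚ (Set.range fun a : F => ∑ φ : F →+* ℂ, (r φ : ℂ) * φ a)`.

THE PRINT.  R. E. Kottwitz, *Points on some Shimura varieties over finite fields*, J. Amer. Math. Soc. 5 (1992)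
[Kottwitz1992] §5 pp. 389–390 (held text `paper:doi-10-2307-2152772` p0017 L40–L50): «Decompose the `B_ℂ`-module `V_ℂ`
as `V_ℂ = V₁ ⊕ V₂` […] Let `E ⊂ ℂ` be the field of definition of the isomorphism class of the complex representation
`V₁` of `B`; the number field `E` is called the reflex field.  Choose a basis `α₁, …, α_t` […] Then
`f(X₁, …, X_t) := det(X₁α₁ + ⋯ + X_tα_t; V₁)` is a homogeneous polynomial […] with coefficients in `ℂ`; since the
isomorphism class of `V₁` is defined over `E`, these coefficients lie in `E`.»  Here `B = F` is a number field, so that a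
complex representation of `F` is `⊕_φ φ^{r_φ}` and its isomorphism class IS the multiplicity function
`r : Hom(F, ℂ) → ℕ`; `τ ∈ Aut(ℂ)` carries the class of `r` to that of `φ ↦ r_{τ⁻¹φ}`, so «the field of definition of
the isomorphism class» is the fixed field of `Stab(r) = {τ ∣ r_{τφ} = r_φ ∀φ}`, and `tr(a ∣ V₁) = ∑_φ r_φ φ(a)`,
`det(X − a ∣ V₁) = ∏_φ (X − φ(a))^{r_φ}`.  M. Rapoport, B. Smithling, W. Zhang [RapoportSmithlingZhang2017]
Introduction p. 2: «`r : Hom(F, ℂ) → {0, 1, n−1, n}` […] the field `E ⊂ ℚ̄` which is the composite of the reflex field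
of `r` and the reflex field of `Φ`»; §3.1 eq. (3.1).  G. Shimura (1998) [Shimura1998] §8.3 Prop. 28 (`r = 𝟙_Φ`:
`K* = ℚ(tr_Φ)`, «`γS = S` iff `γ` fixes `K*`»).  J. S. Milne, *Complex Multiplication* (2006) [MilneCM2006] Ch. I §1
Prop. 1.16 (footnote: Dedekind's independence of characters); S. Lang, *Algebra* [Lang2002] VI §4 Thm. 4.1 (Dedekind /
Artin), VIII §1 (the fixed field of `Aut(ℂ/M)` is `M`, the tree's `Complex.mem_subfield_of_forall_ringEquiv`).

WHAT IS PROVED (`F` a number field, `r : (F →+* ℂ) → ℕ` ANY function, `E_r` as displayed above):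

§0 `eq_of_forall_forall_mem_iff` — two number fields in `ℂ` with the same pointwise stabiliser in `Aut(ℂ)` coincide.
§1 `apply_sum_natCast_mul_apply` (`τ(∑ r_φ φ(a)) = ∑ r_{τ⁻¹φ} φ(a)`), **`forall_apply_sum_eq_iff_forall_apply_smul_eq`**
   (Dedekind: `τ` fixes every `∑_φ r_φ φ(a)` iff `r ∘ τ = r`).
§2 **`forall_mem_adjoin_sum_iff`** (`Aut(ℂ/E_r) = Stab(r)` — Kottwitz's definition as a theorem about `ℚ(tr(· ∣ V₁))`),
   `adjoin_sum_le_iSup_fieldRange` (`E_r ⊆ ∏_φ φ(F)`), `finiteDimensional_adjoin_sum` («the number field `E`»),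
   **`mem_adjoin_sum_iff_forall`** (`E_r` is the fixed field of `Stab(r)`), `adjoin_sum_le_iff_forall`, `eq_adjoin_sum_iff_forall`
   («field of definition»: THE number field with stabiliser `Stab(r)`), `adjoin_sum_eq_adjoin_sum_of_forall_iff`
   (`Stab(r) = Stab(r′) ⟹ E_r = E_{r′}`), `adjoin_sum_mul_eq` (`E_{c·r} = E_r`, `c ≠ 0`), `adjoin_sum_const_eq_bot`
   (`E_c = ℚ`: `∑ c φ(a) = c·Tr_{F/ℚ}(a)`).
§3 **`coeff_prod_X_sub_C_pow_mem_adjoin_sum`** — Kottwitz's «these coefficients lie in `E`» for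
   `det(X − a ∣ V₁) = ∏_φ (X − φ(a))^{r_φ}` (`map_prod_X_sub_C_pow_eq_of_forall_apply_smul_eq`: `Stab(r)` fixes the polynomial).
§4 **`adjoin_sum_indicator_eq_traceField`** — `r = 𝟙_Φ`: `E_r = K* = ℚ(tr_Φ)` (Shimura's Prop. 28 is the case `r ∈ {0,1}`).
§5 RSZ's `r` (clauses as hypotheses, as in g28-#1; `F` CM): **`adjoin_sum_sup_traceField_eq_traceField_sup_fieldRange`**
   — «`E` IS THE COMPOSITE OF THE REFLEX FIELD OF `r` AND THE REFLEX FIELD OF `Φ`»: `E_r · E_Φ = E_Φ · φ₀(F)` (any `n`), and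
   for `n ≥ 3` **`adjoin_sum_eq_traceField_sup_fieldRange`** (`E_r = E`), `traceField_le_adjoin_sum`, `apply_mem_adjoin_sum`.

## References

* [Kottwitz1992] R. E. Kottwitz, *Points on some Shimura varieties over finite fields*, J. Amer. Math. Soc. 5 (1992),
  373–444, §5 pp. 389–390.
* [RapoportSmithlingZhang2017] M. Rapoport, B. Smithling, W. Zhang, *Arithmetic diagonal cycles on unitary Shimura
  varieties*, Compositio Math. 156 (2020); arXiv:1710.06962v3 Introduction p. 2, §3.1 eq. (3.1).
* [Shimura1998] G. Shimura, *Abelian Varieties with Complex Multiplication and Modular Functions* (1998), §8.3 Prop. 28.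
* [MilneCM2006] J. S. Milne, *Complex Multiplication* (2006), Ch. I §1 Prop. 1.16, Def. 1.17.
* [Lang2002] S. Lang, *Algebra*, 3rd ed. (2002), VI §4 Thm. 4.1, VIII §1.
* [MilneFT2022] J. S. Milne, *Fields and Galois Theory* (2022), Cor. 5.15 (trace as a sum over embeddings).

## Provenance

Lane `lit-hodgefound` (HOME `run/shared/lean/pub/lit-hodgefound/`), prover seat `lit-hodgefound-p11` (gen 28),
self-proposed row g28-#4 (lane INBOX claim 2026-08-27), sequel of g28-#1.
-/

set_option autoImplicit false

noncomputable section

open scoped Cardinal Polynomial Classical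
open NumberField Module IntermediateField Polynomial

namespace Literature.NumberTheory.ComplexMultiplication

open Literature.AlgebraicGeometry.Motives (CMType)
open Literature.FieldTheory.AlgClosed (Complex.mem_subfield_of_forall_ringEquiv)

variable {F : Type} [Field F]

/-! ## §0 Preliminaries: Galois theory in `ℂ` and Dedekind with coefficients -/

section Prelim

/-- The points of `ℂ` fixed by one automorphism `τ` form a subfield. [cite: MilneFT2022, Ch. 3 (fixed fields)] -/
private theorem exists_intermediateField_mem_iff_apply_eq_ks (τ : ℂ ≃+* ℂ) :
    ∃ D : IntermediateField ℚ ℂ, ∀ z : ℂ, z ∈ D ↔ τ z = z := by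
  have hq : ∀ q : ℚ, τ (algebraMap ℚ ℂ q) = algebraMap ℚ ℂ q := fun q => by
    rw [eq_ratCast]; exact map_ratCast τ q
  let f : ℂ →ₐ[ℚ] ℂ := (AlgEquiv.ofRingEquiv (f := τ) hq).toAlgHom
  exact ⟨⟨AlgHom.equalizer f (AlgHom.id ℚ ℂ), fun y (hy : τ y = y) => show τ y⁻¹ = y⁻¹ by rw [map_inv₀, hy]⟩,
    fun _ => Iff.rfl⟩

/-- A number field inside `ℂ` is countable. [folklore] -/
private theorem cardinalMk_toSubfield_le_aleph0_ks (M : IntermediateField ℚ ℂ) [FiniteDimensional ℚ M] :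
    #M.toSubfield ≤ ℵ₀ := by
  rw [Cardinal.mk_le_aleph0_iff]
  exact Countable.of_equiv _ (Module.finBasis ℚ M).equivFun.toEquiv.symm

/-- A subfield of a number field inside `ℂ` is a number field. [folklore] -/
private theorem finiteDimensional_of_le_ks {E E' : IntermediateField ℚ ℂ} [FiniteDimensional ℚ E] (h : E' ≤ E) :
    FiniteDimensional ℚ E' :=
  FiniteDimensional.of_injective (IntermediateField.inclusion h).toLinearMap (IntermediateField.inclusion_injective h)

/-- **Two COUNTABLE subfields of `ℂ` with the same pointwise stabiliser in `Aut(ℂ)` are equal** (each is the fixed field of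
its stabiliser). [cite: Lang2002, Ch. VIII §1] -/
theorem eq_of_forall_forall_mem_iff_of_le_aleph0 {M N : IntermediateField ℚ ℂ} (hM : #M.toSubfield ≤ ℵ₀)
    (hN : #N.toSubfield ≤ ℵ₀)
    (h : ∀ τ : ℂ ≃+* ℂ, (∀ z : ℂ, z ∈ M → τ z = z) ↔ ∀ z : ℂ, z ∈ N → τ z = z) : M = N := by
  refine le_antisymm (fun z hz => ?_) (fun z hz => ?_)
  · exact Complex.mem_subfield_of_forall_ringEquiv N.toSubfield hN fun τ hτ => (h τ).2 (fun w hw => hτ w hw) z hz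
  · exact Complex.mem_subfield_of_forall_ringEquiv M.toSubfield hM fun τ hτ => (h τ).1 (fun w hw => hτ w hw) z hz

/-- **Two NUMBER FIELDS in `ℂ` with the same pointwise stabiliser in `Aut(ℂ)` are equal.** [cite: Lang2002, Ch. VIII §1] -/
theorem eq_of_forall_forall_mem_iff {M N : IntermediateField ℚ ℂ} [FiniteDimensional ℚ M] [FiniteDimensional ℚ N]
    (h : ∀ τ : ℂ ≃+* ℂ, (∀ z : ℂ, z ∈ M → τ z = z) ↔ ∀ z : ℂ, z ∈ N → τ z = z) : M = N :=
  eq_of_forall_forall_mem_iff_of_le_aleph0 (cardinalMk_toSubfield_le_aleph0_ks M) (cardinalMk_toSubfield_le_aleph0_ks N) h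

variable [NumberField F]

/-- **Dedekind's independence of characters, with coefficients**: if `∑_φ a_φ φ(x) = ∑_φ b_φ φ(x)` for all `x ∈ F` then
`a = b` (Mathlib's `linearIndependent_monoidHom` along `Hom(F, ℂ) ↪ (F →* ℂ)`; the tree's Hodge-structure-level copy is
`Motives.HodgeStructure.EndAction.eq_of_forall_sum_mul_apply_eq`). [cite: MilneCM2006, Ch. I §1 Prop. 1.16 (proof, footnote)]
[cite: Lang2002, VI §4 Thm. 4.1] -/
private theorem eq_of_forall_sum_mul_apply_eq_ks {a b : (F →+* ℂ) → ℂ} (h : ∀ x : F, ∑ σ, a σ * σ x = ∑ σ, b σ * σ x) :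
    a = b := by
  have hli : LinearIndependent ℂ (fun χ : F →+* ℂ => (χ : F → ℂ)) :=
    (linearIndependent_monoidHom F ℂ).comp (fun χ : F →+* ℂ => χ.toMonoidHom)
      (fun a b hab => RingHom.ext fun x => DFunLike.congr_fun hab x)
  have hsum : ∑ χ, (a χ - b χ) • (χ : F → ℂ) = 0 := by
    funext x
    rw [Finset.sum_apply, Pi.zero_apply]
    simp only [Pi.smul_apply, smul_eq_mul, sub_mul, Finset.sum_sub_distrib, h x, sub_self]
  funext χ
  exact sub_eq_zero.1 (Fintype.linearIndependent_iff.1 hli _ hsum χ)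

/-- The image of an embedding of a number field is finite over `ℚ`. [folklore] -/
private theorem finiteDimensional_fieldRange_ks (s : F →+* ℂ) : FiniteDimensional ℚ s.toRatAlgHom.fieldRange :=
  LinearEquiv.finiteDimensional (AlgEquiv.ofInjectiveField s.toRatAlgHom).toLinearEquiv

/-- `Tr_{F/ℚ}(x) = ∑_{φ : F → ℂ} φ(x)` (sum over ring embeddings). [cite: MilneFT2022, Cor. 5.15 / Prop. 5.14 (trace = sum of conjugates)] -/
theorem ratCast_trace_eq_sum_ringHom_apply (x : F) : ((Algebra.trace ℚ F x : ℚ) : ℂ) = ∑ φ : F →+* ℂ, φ x := by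
  rw [Fintype.sum_equiv RingHom.equivRatAlgHom (fun φ : F →+* ℂ => φ x) (fun σ : F →ₐ[ℚ] ℂ => σ x) fun φ => rfl,
    ← trace_eq_sum_embeddings ℂ, eq_ratCast]

/-- `K* = ℚ(tr_Φ)` is finite over `ℚ`. [folklore] -/
private theorem finiteDimensional_traceField_ks (Ψ : CMType F) : FiniteDimensional ℚ (traceField Ψ) :=
  Module.finite_of_finrank_pos (finrank_traceField_pos Ψ)

end Prelim

variable [NumberField F]

/-! ## §1 The character `a ↦ ∑_φ r_φ φ(a) = tr(a ∣ V₁)` under `Aut(ℂ)` -/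

section Character

variable (r : (F →+* ℂ) → ℕ)

/-- `τ(∑_φ r_φ φ(a)) = ∑_φ r_φ (τφ)(a)`. [cite: Kottwitz1992, §5 p. 390] -/
theorem apply_sum_natCast_mul_apply_eq_sum_smul (τ : ℂ ≃+* ℂ) (a : F) :
    τ (∑ φ : F →+* ℂ, (r φ : ℂ) * φ a) = ∑ φ : F →+* ℂ, (r φ : ℂ) * (τ • φ) a := by
  rw [map_sum]
  exact Finset.sum_congr rfl fun φ _ => by rw [map_mul, map_natCast, ringEquiv_smul_apply]

/-- `∑_φ r_φ (τφ)(a) = ∑_ψ r_{τ⁻¹ψ} ψ(a)` (reindex along `φ ↦ τφ`): `τ` carries the class of `V₁ = ⊕ φ^{r_φ}` to that of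
`ψ ↦ r_{τ⁻¹ψ}`. [cite: Kottwitz1992, §5 p. 390] -/
theorem sum_natCast_mul_smul_apply_eq (τ : ℂ ≃+* ℂ) (a : F) :
    ∑ φ : F →+* ℂ, (r φ : ℂ) * (τ • φ) a = ∑ ψ : F →+* ℂ, (r (τ⁻¹ • ψ) : ℂ) * ψ a :=
  Fintype.sum_equiv (MulAction.toPerm τ) _ _ fun φ => by
    simp only [MulAction.toPerm_apply, inv_smul_smul]

/-- `τ(∑_φ r_φ φ(a)) = ∑_ψ r_{τ⁻¹ψ} ψ(a)`. [cite: Kottwitz1992, §5 p. 390] -/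
theorem apply_sum_natCast_mul_apply (τ : ℂ ≃+* ℂ) (a : F) :
    τ (∑ φ : F →+* ℂ, (r φ : ℂ) * φ a) = ∑ ψ : F →+* ℂ, (r (τ⁻¹ • ψ) : ℂ) * ψ a := by
  rw [apply_sum_natCast_mul_apply_eq_sum_smul, sum_natCast_mul_smul_apply_eq]

/-- **`τ` fixes the character `a ↦ ∑_φ r_φ φ(a)` iff `r ∘ τ = r`** (`⟸` reindex; `⟹` Dedekind's independence of the
embeddings `F → ℂ`, with the integer coefficients `r_{τ⁻¹ψ} − r_ψ`): the isomorphism class of `V₁` is defined over the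
fixed field of `τ` iff `V₁^τ ≅ V₁`. [cite: Kottwitz1992, §5 p. 390] [cite: MilneCM2006, Ch. I §1 Prop. 1.16 (footnote)] -/
theorem forall_apply_sum_eq_iff_forall_apply_smul_eq (τ : ℂ ≃+* ℂ) :
    (∀ a : F, τ (∑ φ : F →+* ℂ, (r φ : ℂ) * φ a) = ∑ φ : F →+* ℂ, (r φ : ℂ) * φ a) ↔
      ∀ φ : F →+* ℂ, r (τ • φ) = r φ := by
  constructor
  · intro h φ
    have hfun : (fun ψ : F →+* ℂ => (r (τ⁻¹ • ψ) : ℂ)) = fun ψ => (r ψ : ℂ) :=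
      eq_of_forall_sum_mul_apply_eq_ks fun x => by rw [← apply_sum_natCast_mul_apply, h x]
    have hψ := congr_fun hfun (τ • φ)
    simp only [inv_smul_smul, Nat.cast_inj] at hψ
    exact hψ.symm
  · intro h a
    rw [apply_sum_natCast_mul_apply]
    exact Finset.sum_congr rfl fun ψ _ => by rw [← h (τ⁻¹ • ψ), smul_inv_smul]

end Character

/-! ## §2 The reflex field `E_r = ℚ(∑_φ r_φ φ(a) ∣ a ∈ F)`: `Aut(ℂ/E_r) = Stab(r)`, a number field, the fixed field of `Stab(r)` -/

section ReflexField

variable (r : (F →+* ℂ) → ℕ)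

/-- **KOTTWITZ'S REFLEX FIELD: `Aut(ℂ/E_r) = Stab(r)`** — `τ` fixes `E_r = ℚ(∑_φ r_φ φ(a) ∣ a ∈ F)` pointwise iff
`r_{τφ} = r_φ` for every `φ`, i.e. iff `τ` fixes the isomorphism class of `V₁ = ⊕_φ φ^{r_φ}` («the field of definition
of the isomorphism class of the complex representation `V₁`»). [cite: Kottwitz1992, §5 pp. 389–390]
[cite: MilneCM2006, Ch. I §1 Prop. 1.16] -/
theorem forall_mem_adjoin_sum_iff (τ : ℂ ≃+* ℂ) :
    (∀ z : ℂ, z ∈ IntermediateField.adjoin ℚ (Set.range fun a : F => ∑ φ : F →+* ℂ, (r φ : ℂ) * φ a) → τ z = z) ↔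
      ∀ φ : F →+* ℂ, r (τ • φ) = r φ := by
  rw [← forall_apply_sum_eq_iff_forall_apply_smul_eq]
  constructor
  · intro h a
    exact h _ (IntermediateField.subset_adjoin ℚ _ ⟨a, rfl⟩)
  · intro h
    obtain ⟨D, hD⟩ := exists_intermediateField_mem_iff_apply_eq_ks τ
    have hle : IntermediateField.adjoin ℚ (Set.range fun a : F => ∑ φ : F →+* ℂ, (r φ : ℂ) * φ a) ≤ D := by
      rw [IntermediateField.adjoin_le_iff]
      rintro _ ⟨a, rfl⟩
      exact (hD _).2 (h a)
    exact fun z hz => (hD z).1 (hle hz)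

/-- **`E_r ⊆ ∏_φ φ(F)`**: the reflex field lies in the compositum of the conjugates of `F` in `ℂ` (each generator
`∑ r_φ φ(a)` does). [cite: Kottwitz1992, §5 p. 390] [cite: MilneCM2006, Ch. I §1 Def. 1.17 (`E* ⊆` Galois closure)] -/
theorem adjoin_sum_le_iSup_fieldRange :
    IntermediateField.adjoin ℚ (Set.range fun a : F => ∑ φ : F →+* ℂ, (r φ : ℂ) * φ a) ≤
      ⨆ φ : F →+* ℂ, φ.toRatAlgHom.fieldRange := by
  rw [IntermediateField.adjoin_le_iff]
  rintro _ ⟨a, rfl⟩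
  refine sum_mem fun φ _ => mul_mem (IntermediateField.natCast_mem _ (r φ)) ?_
  exact (le_iSup (fun φ : F →+* ℂ => φ.toRatAlgHom.fieldRange) φ) (AlgHom.mem_fieldRange.2 ⟨a, rfl⟩)

/-- **«the number field `E`»**: `E_r` is finite over `ℚ`. [cite: Kottwitz1992, §5 p. 390] -/
theorem finiteDimensional_adjoin_sum :
    FiniteDimensional ℚ (IntermediateField.adjoin ℚ (Set.range fun a : F => ∑ φ : F →+* ℂ, (r φ : ℂ) * φ a)) := by
  haveI : ∀ φ : F →+* ℂ, FiniteDimensional ℚ φ.toRatAlgHom.fieldRange := fun φ => finiteDimensional_fieldRange_ks φ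
  haveI : FiniteDimensional ℚ (⨆ φ : F →+* ℂ, φ.toRatAlgHom.fieldRange : IntermediateField ℚ ℂ) :=
    IntermediateField.finiteDimensional_iSup_of_finite
  exact finiteDimensional_of_le_ks (adjoin_sum_le_iSup_fieldRange r)

/-- **`E_r` IS THE FIXED FIELD OF `Stab(r)`**: `z ∈ E_r` iff `z` is fixed by every `τ ∈ Aut(ℂ)` with `r ∘ τ = r` (Kottwitz's
«field of definition of the isomorphism class of `V₁`» equals `ℚ(tr(a ∣ V₁) ∣ a ∈ F)`). [cite: Kottwitz1992, §5 pp. 389–390]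
[cite: Lang2002, Ch. VIII §1] -/
theorem mem_adjoin_sum_iff_forall (z : ℂ) :
    z ∈ IntermediateField.adjoin ℚ (Set.range fun a : F => ∑ φ : F →+* ℂ, (r φ : ℂ) * φ a) ↔
      ∀ τ : ℂ ≃+* ℂ, (∀ φ : F →+* ℂ, r (τ • φ) = r φ) → τ z = z := by
  constructor
  · intro hz τ hτ
    exact (forall_mem_adjoin_sum_iff r τ).2 hτ z hz
  · intro h
    haveI := finiteDimensional_adjoin_sum r
    exact Complex.mem_subfield_of_forall_ringEquiv
      (IntermediateField.adjoin ℚ (Set.range fun a : F => ∑ φ : F →+* ℂ, (r φ : ℂ) * φ a)).toSubfield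
      (cardinalMk_toSubfield_le_aleph0_ks _) fun τ hτ => h τ ((forall_mem_adjoin_sum_iff r τ).1 hτ)

/-- **`E_r ⊆ M ⟺ Aut(ℂ/M) ⊆ Stab(r)`** for a number field `M ⊂ ℂ`. [cite: Kottwitz1992, §5 p. 390] [cite: Lang2002, Ch. VIII §1] -/
theorem adjoin_sum_le_iff_forall (M : IntermediateField ℚ ℂ) [FiniteDimensional ℚ M] :
    IntermediateField.adjoin ℚ (Set.range fun a : F => ∑ φ : F →+* ℂ, (r φ : ℂ) * φ a) ≤ M ↔
      ∀ τ : ℂ ≃+* ℂ, (∀ z : ℂ, z ∈ M → τ z = z) → ∀ φ : F →+* ℂ, r (τ • φ) = r φ := by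
  constructor
  · intro hle τ hτ
    exact (forall_mem_adjoin_sum_iff r τ).1 fun z hz => hτ z (hle hz)
  · intro h z hz
    exact Complex.mem_subfield_of_forall_ringEquiv M.toSubfield (cardinalMk_toSubfield_le_aleph0_ks M) fun τ hτ =>
      (mem_adjoin_sum_iff_forall r z).1 hz τ (h τ fun w hw => hτ w hw)

/-- **«THE FIELD OF DEFINITION»: `E_r` is THE number field `M ⊂ ℂ` with `Aut(ℂ/M) = Stab(r)`.** [cite: Kottwitz1992, §5 pp. 389–390]
[cite: Lang2002, Ch. VIII §1] -/
theorem eq_adjoin_sum_iff_forall (M : IntermediateField ℚ ℂ) [FiniteDimensional ℚ M] :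
    M = IntermediateField.adjoin ℚ (Set.range fun a : F => ∑ φ : F →+* ℂ, (r φ : ℂ) * φ a) ↔
      ∀ τ : ℂ ≃+* ℂ, (∀ z : ℂ, z ∈ M → τ z = z) ↔ ∀ φ : F →+* ℂ, r (τ • φ) = r φ := by
  haveI := finiteDimensional_adjoin_sum r
  constructor
  · rintro rfl τ
    exact forall_mem_adjoin_sum_iff r τ
  · intro h
    exact eq_of_forall_forall_mem_iff fun τ => (h τ).trans (forall_mem_adjoin_sum_iff r τ).symm

/-- **`Stab(r) = Stab(r′) ⟹ E_r = E_{r′}`**: the reflex field depends only on the stabiliser. [cite: Kottwitz1992, §5 p. 390]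
[cite: Lang2002, Ch. VIII §1] -/
theorem adjoin_sum_eq_adjoin_sum_of_forall_iff {r' : (F →+* ℂ) → ℕ}
    (h : ∀ τ : ℂ ≃+* ℂ, (∀ φ : F →+* ℂ, r (τ • φ) = r φ) ↔ ∀ φ : F →+* ℂ, r' (τ • φ) = r' φ) :
    IntermediateField.adjoin ℚ (Set.range fun a : F => ∑ φ : F →+* ℂ, (r φ : ℂ) * φ a) =
      IntermediateField.adjoin ℚ (Set.range fun a : F => ∑ φ : F →+* ℂ, (r' φ : ℂ) * φ a) := by
  haveI := finiteDimensional_adjoin_sum r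
  haveI := finiteDimensional_adjoin_sum r'
  exact eq_of_forall_forall_mem_iff fun τ =>
    (forall_mem_adjoin_sum_iff r τ).trans ((h τ).trans (forall_mem_adjoin_sum_iff r' τ).symm)

/-- **`E_{c·r} = E_r` for `c ≠ 0`** (`V₁^{⊕c}` has the same field of definition). [cite: Kottwitz1992, §5 p. 390] -/
theorem adjoin_sum_mul_eq {c : ℕ} (hc : c ≠ 0) :
    IntermediateField.adjoin ℚ (Set.range fun a : F => ∑ φ : F →+* ℂ, ((c * r φ : ℕ) : ℂ) * φ a) =
      IntermediateField.adjoin ℚ (Set.range fun a : F => ∑ φ : F →+* ℂ, (r φ : ℂ) * φ a) :=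
  adjoin_sum_eq_adjoin_sum_of_forall_iff (fun φ => c * r φ) fun _ => forall_congr' fun _ => Nat.mul_right_inj hc

/-- **A CONSTANT signature has reflex field `ℚ`**: `∑_φ c·φ(a) = c·Tr_{F/ℚ}(a) ∈ ℚ`, so `E_c = ℚ` (`V₁ = (F ⊗ ℂ)^{⊕c}` is
defined over `ℚ`). [cite: Kottwitz1992, §5 p. 390] [cite: MilneFT2022, Cor. 5.15] -/
theorem adjoin_sum_const_eq_bot (c : ℕ) :
    IntermediateField.adjoin ℚ (Set.range fun a : F => ∑ φ : F →+* ℂ, ((fun _ => c : (F →+* ℂ) → ℕ) φ : ℂ) * φ a) = ⊥ := by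
  rw [eq_bot_iff, IntermediateField.adjoin_le_iff]
  rintro _ ⟨a, rfl⟩
  change ∑ φ : F →+* ℂ, (c : ℂ) * φ a ∈ ((⊥ : IntermediateField ℚ ℂ) : Set ℂ)
  rw [← Finset.mul_sum, ← ratCast_trace_eq_sum_ringHom_apply, SetLike.mem_coe, IntermediateField.mem_bot]
  exact ⟨(c : ℚ) * Algebra.trace ℚ F a, by push_cast; rfl⟩

end ReflexField

/-! ## §3 Kottwitz's determinant polynomial `det(X − a ∣ V₁) = ∏_φ (X − φ(a))^{r_φ}` has coefficients in `E_r` -/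

section Determinant

variable (r : (F →+* ℂ) → ℕ)

/-- `τ` acts on `∏_φ (X − φ(a))^{r_φ}` by `φ ↦ τφ`; **if `r ∘ τ = r` the polynomial is fixed.** [cite: Kottwitz1992, §5 p. 390] -/
theorem map_prod_X_sub_C_pow_eq_of_forall_apply_smul_eq {τ : ℂ ≃+* ℂ} (hr : ∀ φ : F →+* ℂ, r (τ • φ) = r φ) (a : F) :
    (∏ φ : F →+* ℂ, (X - C (φ a)) ^ r φ).map (τ : ℂ →+* ℂ) = ∏ φ : F →+* ℂ, (X - C (φ a)) ^ r φ := by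
  rw [Polynomial.map_prod]
  simp only [Polynomial.map_pow, Polynomial.map_sub, Polynomial.map_X, Polynomial.map_C]
  -- reindex along `φ ↦ τφ`
  refine Fintype.prod_equiv (MulAction.toPerm τ) _ _ fun φ => ?_
  rw [MulAction.toPerm_apply, hr φ]
  rfl

/-- **KOTTWITZ: «these coefficients lie in `E`»** — every coefficient of `det(X − a ∣ V₁) = ∏_φ (X − φ(a))^{r_φ}` lies in the
reflex field `E_r` (it is fixed by `Stab(r) = Aut(ℂ/E_r)`). [cite: Kottwitz1992, §5 p. 390] [cite: Lang2002, Ch. VIII §1] -/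
theorem coeff_prod_X_sub_C_pow_mem_adjoin_sum (a : F) (k : ℕ) :
    (∏ φ : F →+* ℂ, (X - C (φ a)) ^ r φ).coeff k ∈
      IntermediateField.adjoin ℚ (Set.range fun a : F => ∑ φ : F →+* ℂ, (r φ : ℂ) * φ a) := by
  refine (mem_adjoin_sum_iff_forall r _).2 fun τ hτ => ?_
  have h := congr_arg (fun p : ℂ[X] => p.coeff k) (map_prod_X_sub_C_pow_eq_of_forall_apply_smul_eq r hτ a)
  simp only [Polynomial.coeff_map] at h
  exact h

/-- In particular the trace `∑_φ r_φ φ(a)` (a generator) and the determinant `∏_φ φ(a)^{r_φ}` lie in `E_r`.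
[cite: Kottwitz1992, §5 p. 390] -/
theorem prod_apply_pow_mem_adjoin_sum (a : F) :
    ∏ φ : F →+* ℂ, φ a ^ r φ ∈ IntermediateField.adjoin ℚ (Set.range fun a : F => ∑ φ : F →+* ℂ, (r φ : ℂ) * φ a) := by
  refine (mem_adjoin_sum_iff_forall r _).2 fun τ hτ => ?_
  rw [map_prod]
  simp only [map_pow]
  refine Fintype.prod_equiv (MulAction.toPerm τ) _ _ fun φ => ?_
  rw [MulAction.toPerm_apply, hτ φ]
  rfl

end Determinant

/-! ## §4 `r = 𝟙_Φ`: Shimura's `K* = ℚ(tr_Φ)` -/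

section Indicator

/-- `∑_φ 𝟙_Φ(φ) φ(a) = tr_Φ(a)`. [cite: Shimura1998, §8.3 Prop. 28] -/
theorem sum_natCast_indicator_mul_apply_eq_cmTypeTrace (Φ : CMType F) (a : F) :
    ∑ φ : F →+* ℂ, ((if φ ∈ Φ.1 then 1 else 0 : ℕ) : ℂ) * φ a = cmTypeTrace Φ a := by
  classical
  rw [cmTypeTrace_apply]
  have hS : (Set.toFinite Φ.1).toFinset = Finset.univ.filter fun φ : F →+* ℂ => φ ∈ Φ.1 := by
    ext φ
    simp only [Set.Finite.mem_toFinset, Finset.mem_filter, Finset.mem_univ, true_and]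
  rw [hS, Finset.sum_filter]
  exact Finset.sum_congr rfl fun φ _ => by split_ifs <;> simp

/-- **`E_{𝟙_Φ} = K* = ℚ(tr_Φ)`**: for the indicator signature of a CM type, Kottwitz's reflex field is Shimura's.
[cite: Shimura1998, §8.3 Prop. 28] [cite: Kottwitz1992, §5 p. 390] [cite: MilneCM2006, Ch. I §1 Def. 1.17, Prop. 1.18] -/
theorem adjoin_sum_indicator_eq_traceField (Φ : CMType F) :
    IntermediateField.adjoin ℚ (Set.range fun a : F => ∑ φ : F →+* ℂ,
        ((fun ψ => if ψ ∈ Φ.1 then 1 else 0 : (F →+* ℂ) → ℕ) φ : ℂ) * φ a) = traceField Φ := by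
  have h : (fun a : F => ∑ φ : F →+* ℂ, ((fun ψ => if ψ ∈ Φ.1 then 1 else 0 : (F →+* ℂ) → ℕ) φ : ℂ) * φ a) =
      cmTypeTrace Φ := funext fun a => sum_natCast_indicator_mul_apply_eq_cmTypeTrace Φ a
  rw [h]
  rfl

omit [NumberField F] in
/-- `Stab(𝟙_Φ) = Stab(Φ)`. [cite: Shimura1998, §8.3 Prop. 28] -/
theorem forall_indicator_smul_eq_iff (Φ : CMType F) (τ : ℂ ≃+* ℂ) :
    (∀ φ : F →+* ℂ, (fun ψ => if ψ ∈ Φ.1 then 1 else 0 : (F →+* ℂ) → ℕ) (τ • φ) =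
        (fun ψ => if ψ ∈ Φ.1 then 1 else 0 : (F →+* ℂ) → ℕ) φ) ↔
      ∀ χ : F →+* ℂ, τ • χ ∈ Φ.1 ↔ χ ∈ Φ.1 := by
  refine forall_congr' fun φ => ?_
  by_cases h1 : τ • φ ∈ Φ.1 <;> by_cases h2 : φ ∈ Φ.1 <;> simp [h1, h2]

end Indicator

/-! ## §5 RSZ's `r`: `E_r · E_Φ = E_Φ · φ₀(F)` and, for `n ≥ 3`, `E_r = E` -/

section RSZ

variable [IsCMField F] {Φ : CMType F} {φ₀ : F →+* ℂ} {n : ℕ} {r : (F →+* ℂ) → ℕ}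
  (hφ₀ : φ₀ ∈ Φ.1) (h₀ : r φ₀ = 1) (hΦ : ∀ φ : F →+* ℂ, φ ∈ Φ.1 → φ ≠ φ₀ → r φ = 0)
  (hc : ∀ φ : F →+* ℂ, φ ∉ Φ.1 → r φ = n - r (ComplexEmbedding.conjugate φ))

include hφ₀ h₀ hΦ hc in
/-- **«`E` IS THE COMPOSITE OF THE REFLEX FIELD OF `r` AND THE REFLEX FIELD OF `Φ`»: `E_r · E_Φ = E_Φ · φ₀(F)`** for RSZ's
signature function `r` (`r_{φ₀} = 1`, `r = 0` on `Φ ∖ {φ₀}`, `r_φ = n − r_φ̄` off `Φ`; `F` CM; any `n`) — both sides are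
number fields in `ℂ` with pointwise stabiliser `Stab(r) ∩ Stab(Φ) = Stab(Φ) ∩ Stab(φ₀)` (g28-#1 `forall_apply_smul_eq_and_iff`,
eq. (3.1)). [cite: RapoportSmithlingZhang2017, Introduction p. 2] [cite: RapoportSmithlingZhang2017, §3.1 eq. (3.1)]
[cite: Kottwitz1992, §5 p. 390] [cite: Lang2002, Ch. VIII §1] -/
theorem adjoin_sum_sup_traceField_eq_traceField_sup_fieldRange :
    IntermediateField.adjoin ℚ (Set.range fun a : F => ∑ φ : F →+* ℂ, (r φ : ℂ) * φ a) ⊔ traceField Φ =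
      traceField Φ ⊔ φ₀.toRatAlgHom.fieldRange := by
  haveI := finiteDimensional_adjoin_sum r
  haveI := finiteDimensional_traceField_ks Φ
  haveI := finiteDimensional_fieldRange_ks φ₀
  haveI : FiniteDimensional ℚ
      (IntermediateField.adjoin ℚ (Set.range fun a : F => ∑ φ : F →+* ℂ, (r φ : ℂ) * φ a) ⊔ traceField Φ :
        IntermediateField ℚ ℂ) :=
    IntermediateField.finiteDimensional_sup _ _
  haveI : FiniteDimensional ℚ (traceField Φ ⊔ φ₀.toRatAlgHom.fieldRange : IntermediateField ℚ ℂ) :=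
    IntermediateField.finiteDimensional_sup _ _
  refine eq_of_forall_forall_mem_iff fun τ => ?_
  rw [forall_mem_sup_iff, forall_mem_adjoin_sum_iff, ← forall_smul_mem_iff_iff_forall_apply_traceField_eq,
    forall_apply_smul_eq_and_iff hφ₀ h₀ hΦ hc τ, forall_mem_traceField_sup_fieldRange_iff]

include hφ₀ h₀ hΦ hc in
/-- **`n ≥ 3`: `E_r = E = E_Φ · φ₀(F)`** — the reflex field of RSZ's `r` alone is already `E` (`Stab(r) = Stab(Φ) ∩ Stab(φ₀)`,
g28-#1 `forall_apply_smul_eq_iff`). [cite: RapoportSmithlingZhang2017, Introduction p. 2] [cite: RapoportSmithlingZhang2017, §3.1 eq. (3.1)]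
[cite: Kottwitz1992, §5 p. 390] -/
theorem adjoin_sum_eq_traceField_sup_fieldRange (h3 : 3 ≤ n) :
    IntermediateField.adjoin ℚ (Set.range fun a : F => ∑ φ : F →+* ℂ, (r φ : ℂ) * φ a) =
      traceField Φ ⊔ φ₀.toRatAlgHom.fieldRange := by
  haveI := finiteDimensional_adjoin_sum r
  haveI := finiteDimensional_traceField_ks Φ
  haveI := finiteDimensional_fieldRange_ks φ₀
  haveI : FiniteDimensional ℚ (traceField Φ ⊔ φ₀.toRatAlgHom.fieldRange : IntermediateField ℚ ℂ) :=
    IntermediateField.finiteDimensional_sup _ _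
  refine eq_of_forall_forall_mem_iff fun τ => ?_
  rw [forall_mem_adjoin_sum_iff, forall_apply_smul_eq_iff_forall_mem_traceField_sup_fieldRange hφ₀ h₀ hΦ hc h3]

include hφ₀ h₀ hΦ hc in
/-- `n ≥ 3`: `E_Φ ⊆ E_r`. [cite: RapoportSmithlingZhang2017, Introduction p. 2 and §3.1 Remark 3.1 (i)] -/
theorem traceField_le_adjoin_sum (h3 : 3 ≤ n) :
    traceField Φ ≤ IntermediateField.adjoin ℚ (Set.range fun a : F => ∑ φ : F →+* ℂ, (r φ : ℂ) * φ a) := by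
  rw [adjoin_sum_eq_traceField_sup_fieldRange hφ₀ h₀ hΦ hc h3]
  exact le_sup_left

include hφ₀ h₀ hΦ hc in
/-- `n ≥ 3`: `φ₀(F) ⊆ E_r` («`E` contains `F` via `φ₀`»). [cite: RapoportSmithlingZhang2017, Introduction p. 2] -/
theorem apply_mem_adjoin_sum (h3 : 3 ≤ n) (x : F) :
    φ₀ x ∈ IntermediateField.adjoin ℚ (Set.range fun a : F => ∑ φ : F →+* ℂ, (r φ : ℂ) * φ a) := by
  rw [adjoin_sum_eq_traceField_sup_fieldRange hφ₀ h₀ hΦ hc h3]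
  exact apply_mem_traceField_sup_fieldRange Φ φ₀ x

include hφ₀ h₀ hΦ hc in
/-- Any `n`: `E_r ⊆ E` (`Aut(ℂ/E) = Stab(Φ) ∩ Stab(φ₀) ≤ Stab(r)`). [cite: RapoportSmithlingZhang2017, Introduction p. 2]
[cite: RapoportSmithlingZhang2017, §3.1 eq. (3.1)] -/
theorem adjoin_sum_le_traceField_sup_fieldRange :
    IntermediateField.adjoin ℚ (Set.range fun a : F => ∑ φ : F →+* ℂ, (r φ : ℂ) * φ a) ≤
      traceField Φ ⊔ φ₀.toRatAlgHom.fieldRange := by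
  rw [← adjoin_sum_sup_traceField_eq_traceField_sup_fieldRange hφ₀ h₀ hΦ hc]
  exact le_sup_left

end RSZ

end Literature.NumberTheory.ComplexMultiplication

end
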